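import Mathlib
import Literature.Computability.Complexity.RandomKSatEnsembleOGP

/-!
# Route OverlapGapAlgebra, crux `SearchHardWindow` (stmt-PneNP-2460): `EnsembleOGP → Obstructions`

Logic glue of line `Sketch` (Line A). The named fact `HuangSellke2025KSatObstructions`
(`Literature/Computability/Complexity/RandomKSatEnsembleOGP.lean`; Huang–Sellke 2025,
arXiv:2501.06427 §3.3.2, Lemmas 3.22–3.23) is the conjunction, eventually in `n`, of two first-moment
bounds on the `ε`-resampling chain of random `k`-SAT literal arrays: the ensemble OGP (Lemma 3.22) and
the chaos bound (Lemma 3.23). The chaos half is proved summit-side as a theorem for every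
`β < 5 log k / k` (hypothesis `hChaos`); the OGP half is the smaller named fact
`HuangSellke2025KSatEnsembleOGP`, which records `β < 5 log k / k` (hypothesis `hOGP`, inlined
verbatim).

`stub_obstructionsOfOGP` assembles the two: take the threshold `max k₀ 2`, the OGP's constants
`β, η`, the chaos's `b₁`, and for the rate the minimum `c = min c₁ c₂` of the two rates, using
`exp (-(cᵢ n)) ≤ exp (-(min c₁ c₂ · n))`.
-/

set_option linter.dupNamespace false -- `Summit.PneNP.PneNP.…`: summit = sub-problem

namespace Summit.PneNP.PneNP.Theorems

open Finset Filter Asymptotics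
open Literature.Computability.Complexity
open scoped Classical

/-- Weakening an exponential rate: if `c ≤ c'` and `0 ≤ x` then `exp (-(c' x)) ≤ exp (-(c x))`. -/
theorem oog_exp_neg_mul_le {c c' x : ℝ} (hcc' : c ≤ c') (hx : 0 ≤ x) :
    Real.exp (-(c' * x)) ≤ Real.exp (-(c * x)) := by
  apply Real.exp_le_exp.2
  have : c * x ≤ c' * x := mul_le_mul_of_nonneg_right hcc' hx
  linarith

/-- **`EnsembleOGP → Obstructions`** (glue of line `Sketch`, crux `SearchHardWindow`): the ensemble
OGP half (Huang–Sellke 2025 Lemma 3.22, hypothesis `hOGP`, recording `β < 5 log k / k`) and the chaos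
half as a theorem for every `β < 5 log k / k` (Lemma 3.23, hypothesis `hChaos`) together give the named
fact `HuangSellke2025KSatObstructions`: threshold `max k₀ 2`, the OGP's `β, η`, the chaos's `b₁`, and
rate `c = min c₁ c₂`. -/
theorem stub_obstructionsOfOGP
    (hOGP : (∃ k₀ : ℕ, ∀ k : ℕ, k₀ ≤ k → ∃ β η : ℝ, 0 < η ∧ η < β ∧ β < 5 * Real.log k / k ∧
      ∀ D : ℕ → ℕ, (fun n : ℕ => (D n : ℝ)) =o[atTop] (fun n : ℕ => (n : ℝ)) → (∀ n, 1 ≤ D n) →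
        ∀ A : ℕ, ∃ c : ℝ, 0 < c ∧ ∀ᶠ n : ℕ in atTop, ∀ m : ℕ, m = ⌊5 * 2 ^ k * Real.log k / k * n⌋₊ →
          ∀ ε : ℝ, ε = Real.log (n / D n) / n → ∀ K : ℕ, K ≤ n ^ A →
          resampleChainMass ε K (fun y : ℕ → (Fin m × Fin k → Fin n × Bool) =>
              ∃ (t : ℕ → ℕ) (x : ℕ → Fin n → Bool), (∀ ℓ < k, t ℓ ≤ t (ℓ + 1)) ∧ t k ≤ K ∧
                (∀ ℓ ≤ k, ∀ i : Fin m, ∃ j : Fin k, x ℓ (y (t ℓ) (i, j)).1 = (y (t ℓ) (i, j)).2) ∧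
                ∀ ℓ, 1 ≤ ℓ → ℓ ≤ k → overlapCondEnt x ℓ ∈ Set.Icc (β - η) β)
            ≤ Real.exp (-(c * n))))
    (hChaos : ∀ k : ℕ, 2 ≤ k → ∀ β : ℝ, β < 5 * Real.log k / k →
      ∃ b₁ : ℝ, 0 < b₁ ∧ ∀ b : ℝ, 0 < b → b ≤ b₁ → ∀ D : ℕ → ℕ,
        (fun n : ℕ => (D n : ℝ)) =o[atTop] (fun n : ℕ => (n : ℝ)) → (∀ n, 1 ≤ D n) →
        ∀ (a : (n m : ℕ) → (Fin m × Fin k → Fin n × Bool) → (Fin n → Bool)) (A : ℕ),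
        ∃ c : ℝ, 0 < c ∧ ∀ᶠ n : ℕ in atTop, ∀ m : ℕ, m = ⌊5 * 2 ^ k * Real.log k / k * n⌋₊ →
          ∀ ε : ℝ, ε = Real.log (n / D n) / n → ∀ K : ℕ, K ≤ n ^ A →
          resampleChainMass ε K (fun y : ℕ → (Fin m × Fin k → Fin n × Bool) =>
              ∃ (j : ℕ) (t : ℕ → ℕ) (x : Fin n → Bool), 1 ≤ j ∧ j ≤ k ∧
                (∀ ℓ < j, t ℓ ≤ t (ℓ + 1)) ∧ t j ≤ K ∧ (t (j - 1) : ℝ) + 1 / (b * k * ε) ≤ t j ∧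
                (∀ i : Fin m, ∃ j' : Fin k, x (y (t j) (i, j')).1 = (y (t j) (i, j')).2) ∧
                overlapCondEnt (fun ℓ => if ℓ < j then a n m (y (t ℓ)) else x) j ≤ β)
            ≤ Real.exp (-(c * n))) :
    HuangSellke2025KSatObstructions := by
  obtain ⟨k₀, hk₀⟩ := hOGP
  refine ⟨max k₀ 2, fun k hk => ?_⟩
  have hk₀k : k₀ ≤ k := le_trans (le_max_left k₀ 2) hk
  have hk2 : 2 ≤ k := le_trans (le_max_right k₀ 2) hk
  obtain ⟨β, η, hη, hηβ, hβ5, hO⟩ := hk₀ k hk₀k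
  obtain ⟨b₁, hb₁, hC⟩ := hChaos k hk2 β hβ5
  refine ⟨β, η, hη, hηβ, b₁, hb₁, fun b hb hbb D hD hD1 a A => ?_⟩
  obtain ⟨c₁, hc₁, hev₁⟩ := hO D hD hD1 A
  obtain ⟨c₂, hc₂, hev₂⟩ := hC b hb hbb D hD hD1 a A
  refine ⟨min c₁ c₂, lt_min hc₁ hc₂, ?_⟩
  filter_upwards [hev₁, hev₂] with n h₁ h₂
  intro m hm ε hε K hK
  exact ⟨(h₁ m hm ε hε K hK).trans (oog_exp_neg_mul_le (min_le_left c₁ c₂) (Nat.cast_nonneg n)),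
    (h₂ m hm ε hε K hK).trans (oog_exp_neg_mul_le (min_le_right c₁ c₂) (Nat.cast_nonneg n))⟩

end Summit.PneNP.PneNP.Theorems
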